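import Summits.CriticalPhenomena.SAWScalingLimit.Theorems.SAWCompassLatticeSurfaceUniversalityFaceSide
import Summits.CriticalPhenomena.SAWScalingLimit.Theorems.SAWCompassLatticeSurfaceUniversalitySiteDictionary

/-!
# Objects of the line `registered`, IV, for the crux `SAWCompassLattice.SurfaceUniversality`
# (stmt-CriticalPhenomena-6964): the face discretisation IS the site discretisation of the
# one-cell erosion

Route `SAWCompassLattice` (sub-problem `SAWScalingLimit`), line `registered` (birth skeleton v7). The
line rests the crux on `EventualTight` (stmt-1881), the kernel `LipUnifToYB`, and
`LipSiteFaceApproxIndependence`: the critical plus-lattice self-avoiding path laws through the SITE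
discretisation `probeSupport siteRule D δ` (the summit's `meshVertices` / `meshGraph` discretisation
transported to the plus lattice) and through the FACE discretisation `probeSupport faceRule D δ`
(centres of the faces of `D_δ = meshFaces (π/2) D δ` and the ports on their sides) of one Dobrushin
domain, with pinned endpoints, merge at bounded-Lipschitz level. This file records that the face
rule is NOT a second kind of discretisation: on centre-to-centre path laws it is the site rule
applied to the ONE-CELL EROSION of the domain,

  `erode Ω δ = {z | z + δ · F̄ ⊆ Ω}`,  `F̄ = rhombus (π/2) (0, 0) = [0, 1] × [-1/2, 1/2]`

(the closed square of the face `(0, 0)`, whose west port is the origin), exactly and for every real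
`δ` (no sign condition):

* `rhombus_rightAngles_zero_eq`, `mem_rhombus_rightAngles_zero_iff` — the closed unit cell in
  coordinates; `add_mem_rhombus_zero_or` — sliding the cell by `t d`, `t ∈ [0, 1]`, `d ∈ {1, i}`,
  keeps every point in `F̄ ∪ (d + F̄)`;
* `erode`, `erode_subset` (`0 ∈ F̄`), `isBounded_erode`, `erode_mono`, `segment_subset_erode` (a
  lattice step between two eroded-interior points stays eroded-interior);
* `meshPoint_mem_erode_iff` — the mesh point `δ x` of the site `x = ![k, j]` lies in `erode Ω δ` iff
  the face `(k, j) = siteFace x` (west port `δ x`) is a mesh face of `Ω`: the site discretisation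
  of the erosion is the face discretisation;
* `inr_mem_siteSupport_erode_iff` — the site rule on `erode Ω δ` keeps a centre iff the face rule
  on `Ω` does; `inl_mem_siteSupport_erode_of_faces_mem` — it keeps every port both of whose faces
  are mesh faces of `Ω`;
* `faces_mem_support` — on a self-avoiding plus walk a port other than the endpoints is flanked by
  the centres of ITS TWO faces (its two neighbours on the walk are distinct centres adjacent to it);
  hence `forall_mem_support_faceRule_iff_siteRule_erode`: between two centres a self-avoiding plus
  path lies in the face support of `Ω` iff it lies in the site support of `erode Ω δ`;
* `plusPathLaw_faceRule_eq_siteRule_erode`, `mem_plusJoinable_faceRule_iff_siteRule_erode` (and the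
  `siteCentre` spelling `plusPathLaw_faceRule_siteCentre_eq`) — THE IDENTITY: for all centres
  `f, g` and every `δ`, `plusPathLaw (probeSupport faceRule Ω δ) δ f g =
  plusPathLaw (probeSupport siteRule (erode Ω δ) δ) δ f g`, and the same pairs of centres are
  joinable (`pathLaw_congr_support`).

So the mixed case `(siteRule, faceRule)` of `LipSiteFaceApproxIndependence` is robustness of ONE
discretisation rule under `Ω ↦ erode Ω δ ⊆ Ω` (a boundary perturbation of width `≤ |δ|√5/2`) with
re-pinned endpoints. Tagged [folklore] (bookkeeping on the tree's own objects). NOT here: any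
statement about ports as endpoints (a port endpoint sees only ONE of its faces under the face rule),
any limit `δ → 0⁺`.
-/

noncomputable section

namespace Summit.CriticalPhenomena.SAWScalingLimit.Theorems.SurfaceUniversality

open MeasureTheory Filter Topology Set Metric
open scoped NNReal ENNReal BoundedContinuousFunction Pointwise
open Literature.Probability.RandomPlanarGeometry Literature.Probability.RandomPlanarGeometry.SAW
  Literature.Probability.RandomPlanarGeometry.SAW.YangBaxter
open Literature.Probability.LatticeModels (Site meshPoint meshVertices mem_meshVertices_iff)
open Summit.CriticalPhenomena.SAWScalingLimit.Cruxes.HexTransfer.Sketch.Surface (planeCorner_rightAngles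
  colShift_rightAngles)
open Complex (I)

/-! ### The closed unit cell `F̄ = [0, 1] × [-1/2, 1/2]` of the face `(0, 0)` -/

/-- At right angles the four corners of the face `(0, 0)` are `{0, 1} × {-1/2, 1/2}`. [folklore] -/
theorem cornerSet_rightAngles_zero :
    cornerSet rightAngles ((0 : ℤ), (0 : ℤ)) = ({0, 1} : Set ℝ) ×ℂ ({-(1 / 2), 1 / 2} : Set ℝ) := by
  have h0 : planeCorner rightAngles ((0 : ℤ), (0 : ℤ)) = -(I / 2) := by
    rw [planeCorner_rightAngles]
    push_cast
    ring
  ext z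
  simp only [cornerSet, h0, colShift_rightAngles, mem_insert_iff, mem_singleton_iff,
    Complex.mem_reProdIm]
  constructor
  · rintro (rfl | rfl | rfl | rfl) <;> norm_num
  · rintro ⟨h1 | h1, h2 | h2⟩
    · exact Or.inl (Complex.ext (by norm_num [h1]) (by norm_num [h2]))
    · exact Or.inr (Or.inl (Complex.ext (by norm_num [h1]) (by norm_num [h2])))
    · exact Or.inr (Or.inr (Or.inl (Complex.ext (by norm_num [h1]) (by norm_num [h2]))))
    · exact Or.inr (Or.inr (Or.inr (Complex.ext (by norm_num [h1]) (by norm_num [h2]))))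

/-- **At right angles the closed square of the face `(0, 0)` is the box `[0, 1] × [-1/2, 1/2]`**
(the convex hull of `{0, 1} × {-1/2, 1/2}` is the product of the two segments). [folklore] -/
theorem rhombus_rightAngles_zero_eq :
    rhombus rightAngles ((0 : ℤ), (0 : ℤ)) = Icc (0 : ℝ) 1 ×ℂ Icc (-(1 / 2) : ℝ) (1 / 2) := by
  rw [rhombus, cornerSet_rightAngles_zero, Complex.convexHull_reProdIm, convexHull_pair,
    convexHull_pair, segment_eq_Icc (by norm_num : (0 : ℝ) ≤ 1),
    segment_eq_Icc (by norm_num : (-(1 / 2) : ℝ) ≤ 1 / 2)]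

/-- Membership in the closed square of the face `(0, 0)` by coordinates: `0 ≤ re ≤ 1` and
`-1/2 ≤ im ≤ 1/2`. [folklore] -/
theorem mem_rhombus_rightAngles_zero_iff {w : ℂ} :
    w ∈ rhombus rightAngles ((0 : ℤ), (0 : ℤ)) ↔
      (0 ≤ w.re ∧ w.re ≤ 1) ∧ (-(1 / 2) ≤ w.im ∧ w.im ≤ 1 / 2) := by
  rw [rhombus_rightAngles_zero_eq, Complex.mem_reProdIm, mem_Icc, mem_Icc]

/-- The west port `0` of the face `(0, 0)` lies in its closed square. [folklore] -/
theorem zero_mem_rhombus_rightAngles_zero : (0 : ℂ) ∈ rhombus rightAngles ((0 : ℤ), (0 : ℤ)) := by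
  rw [mem_rhombus_rightAngles_zero_iff]
  norm_num

/-- **Sliding the cell along a lattice step**: for `d ∈ {1, i}`, `t ∈ [0, 1]` and `w` in the closed
unit cell `F̄`, the point `t d + w` lies in `F̄` or in `d + F̄` (compare the shifted coordinate with
the far side of the cell). [folklore] -/
theorem add_mem_rhombus_zero_or {d : ℂ} (hd : d = 1 ∨ d = I) {t : ℝ} (ht : t ∈ Icc (0 : ℝ) 1)
    {w : ℂ} (hw : w ∈ rhombus rightAngles ((0 : ℤ), (0 : ℤ))) :
    (t : ℂ) * d + w ∈ rhombus rightAngles ((0 : ℤ), (0 : ℤ)) ∨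
      (t : ℂ) * d + w - d ∈ rhombus rightAngles ((0 : ℤ), (0 : ℤ)) := by
  rw [mem_rhombus_rightAngles_zero_iff] at hw
  rw [mem_rhombus_rightAngles_zero_iff, mem_rhombus_rightAngles_zero_iff]
  rcases hd with rfl | rfl
  · simp only [Complex.add_re, Complex.add_im, Complex.sub_re, Complex.sub_im, Complex.ofReal_re,
      Complex.ofReal_im, Complex.one_re, Complex.one_im, mul_one, sub_zero, zero_add]
    rcases le_or_gt (t + w.re) 1 with h | h
    · exact Or.inl ⟨⟨by linarith [ht.1, hw.1.1], h⟩, hw.2⟩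
    · exact Or.inr ⟨⟨by linarith, by linarith [ht.2, hw.1.2]⟩, hw.2⟩
  · simp only [Complex.add_re, Complex.add_im, Complex.sub_re, Complex.sub_im, Complex.mul_re,
      Complex.mul_im, Complex.ofReal_re, Complex.ofReal_im, Complex.I_re, Complex.I_im,
      mul_one, mul_zero, sub_zero, zero_add, add_zero, sub_self]
    rcases le_or_gt (t + w.im) (1 / 2) with h | h
    · exact Or.inl ⟨hw.1, by linarith [ht.1, hw.2.1], h⟩
    · exact Or.inr ⟨hw.1, by linarith, by linarith [ht.2, hw.2.2]⟩

/-! ### The one-cell erosion of a domain -/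

/-- **The one-cell erosion** of the domain `Ω` at mesh `δ`: the points `z` whose rescaled closed
unit cell `z + δ · F̄`, `F̄ = rhombus (π/2) (0, 0) = [0, 1] × [-1/2, 1/2]` (the closed square of
the face `(0, 0)` of the square tiling, whose west port is the origin), lies in `Ω`. The site
discretisation of `erode Ω δ` is the face discretisation of `Ω`: the mesh point `δ x` of the site
`x = ![k, j]` is eroded-interior iff the closed square of the face `(k, j)` (west port `δ x`) lies
in `Ω` (`meshPoint_mem_erode_iff`). Junk-free for every real `δ` (`δ = 0` gives `Ω` itself).
[folklore] -/
def erode (Ω : Set ℂ) (δ : ℝ) : Set ℂ :=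
  {z | ∀ w ∈ rhombus rightAngles ((0 : ℤ), (0 : ℤ)), z + (δ : ℂ) * w ∈ Ω}

/-- Membership in `erode`, unfolded. [folklore] -/
theorem mem_erode_iff {Ω : Set ℂ} {δ : ℝ} {z : ℂ} :
    z ∈ erode Ω δ ↔ ∀ w ∈ rhombus rightAngles ((0 : ℤ), (0 : ℤ)), z + (δ : ℂ) * w ∈ Ω :=
  Iff.rfl

/-- The erosion lies in the domain (the west port `0` lies in the closed cell). [folklore] -/
theorem erode_subset (Ω : Set ℂ) (δ : ℝ) : erode Ω δ ⊆ Ω := fun z hz => by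
  simpa using hz 0 zero_mem_rhombus_rightAngles_zero

/-- The erosion of a bounded domain is bounded. [folklore] -/
theorem isBounded_erode {Ω : Set ℂ} (h : Bornology.IsBounded Ω) (δ : ℝ) :
    Bornology.IsBounded (erode Ω δ) :=
  h.subset (erode_subset Ω δ)

/-- The erosion is monotone in the domain. [folklore] -/
theorem erode_mono {Ω Ω' : Set ℂ} (h : Ω ⊆ Ω') (δ : ℝ) : erode Ω δ ⊆ erode Ω' δ :=
  fun _ hz w hw => h (hz w hw)

/-- **A lattice step between eroded-interior points stays in the erosion**: if `z` and `z + δ d`,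
`d ∈ {1, i}`, both lie in `erode Ω δ`, so does the closed segment between them (the cell at a point
`z + t δ d` of the segment lies in the union of the two end cells, `add_mem_rhombus_zero_or`).
[folklore] -/
theorem segment_subset_erode {Ω : Set ℂ} {δ : ℝ} {z d : ℂ} (hd : d = 1 ∨ d = I)
    (hz : z ∈ erode Ω δ) (hzd : z + (δ : ℂ) * d ∈ erode Ω δ) :
    segment ℝ z (z + (δ : ℂ) * d) ⊆ erode Ω δ := by
  rw [segment_eq_image']
  rintro _ ⟨t, ht, rfl⟩ w hw
  rcases add_mem_rhombus_zero_or hd ht hw with h | h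
  · convert hz _ h using 1
    simp only [Complex.real_smul]
    ring
  · convert hzd _ h using 1
    simp only [Complex.real_smul]
    ring

/-- The mesh point of a site in complex coordinates: `δ x = δ (x₀ + x₁ i)`. [folklore] -/
theorem meshPoint_eq_mul (δ : ℝ) (x : Site 2) :
    meshPoint δ x = (δ : ℂ) * (((x 0 : ℤ) : ℂ) + ((x 1 : ℤ) : ℂ) * I) :=
  Complex.ext (by simp) (by simp)

/-- **The site discretisation of the erosion is the face discretisation**: the mesh point of the
site `x = ![k, j]` lies in `erode Ω δ` iff the face `siteFace x = (k, j)` (whose west port is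
`δ x`, and whose closed square is `δ x + δ F̄`) is a mesh face of `Ω`. [folklore] -/
theorem meshPoint_mem_erode_iff {Ω : Set ℂ} {δ : ℝ} {x : Site 2} :
    meshPoint δ x ∈ erode Ω δ ↔ siteFace x ∈ meshFaces rightAngles Ω δ :=
  forall_rhombus_zero_iff (siteFace x) fun w => by
    rw [meshPoint_eq_mul, siteFace, planeCorner_rightAngles]
    ring

/-! ### The site support of the erosion versus the face support -/

/-- **Centres**: the site rule on the erosion keeps the centre of the face `f` iff the face rule on
`Ω` does (iff `f` is a mesh face of `Ω`: the site probe of the centre is the west port of `f`).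
[folklore] -/
theorem inr_mem_siteSupport_erode_iff {Ω : Set ℂ} {δ : ℝ} {f : Face} {u : Unit} :
    (Sum.inr (f, u) : PVert) ∈ probeSupport siteRule (erode Ω δ) δ ↔
      (Sum.inr (f, u) : PVert) ∈ probeSupport faceRule Ω δ := by
  obtain ⟨k, j⟩ := f
  rw [inr_mem_faceSupport_iff, show (Sum.inr ((k, j), u) : PVert) = siteCentre ![k, j] from rfl,
    siteCentre_mem_siteSupport_iff, mem_meshVertices_iff, meshPoint_mem_erode_iff]
  rfl

/-- **Ports**: if both faces bordering the port `e` are mesh faces of `Ω`, the site rule on the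
erosion keeps `e`: the closed rescaled `ℤ²`-edge it subdivides joins the west ports of its two
faces, two eroded-interior mesh points one lattice step apart (`segment_subset_erode`). No sign
condition on `δ`. [folklore] -/
theorem inl_mem_siteSupport_erode_of_faces_mem {Ω : Set ℂ} {δ : ℝ} {e : MidEdge}
    (h₁ : e.faces.1 ∈ meshFaces rightAngles Ω δ) (h₂ : e.faces.2 ∈ meshFaces rightAngles Ω δ) :
    (Sum.inl e : PVert) ∈ probeSupport siteRule (erode Ω δ) δ := by
  rw [inl_mem_siteSupport_iff]
  refine Subset.trans ?_ subset_closure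
  cases e with
  | vert k j =>
    have hp₁ : meshPoint δ ![k - 1, j] ∈ erode Ω δ :=
      (meshPoint_mem_erode_iff (x := ![k - 1, j])).2 h₁
    have hp₂ : meshPoint δ ![k, j] ∈ erode Ω δ := (meshPoint_mem_erode_iff (x := ![k, j])).2 h₂
    have heq : meshPoint δ ![k, j] = meshPoint δ ![k - 1, j] + (δ : ℂ) * 1 := by
      rw [meshPoint_vec, meshPoint_vec]
      push_cast
      ring
    show segment ℝ (meshPoint δ ![k - 1, j]) (meshPoint δ ![k, j]) ⊆ erode Ω δ
    rw [heq] at hp₂ ⊢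
    exact segment_subset_erode (Or.inl rfl) hp₁ hp₂
  | slant k j =>
    have hp₁ : meshPoint δ ![k, j - 1] ∈ erode Ω δ :=
      (meshPoint_mem_erode_iff (x := ![k, j - 1])).2 h₁
    have hp₂ : meshPoint δ ![k, j] ∈ erode Ω δ := (meshPoint_mem_erode_iff (x := ![k, j])).2 h₂
    have heq : meshPoint δ ![k, j] = meshPoint δ ![k, j - 1] + (δ : ℂ) * I := by
      rw [meshPoint_vec, meshPoint_vec]
      push_cast
      ring
    show segment ℝ (meshPoint δ ![k, j - 1]) (meshPoint δ ![k, j]) ⊆ erode Ω δ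
    rw [heq] at hp₂ ⊢
    exact segment_subset_erode (Or.inr rfl) hp₁ hp₂

/-! ### Self-avoiding plus paths between centres -/

/-- **On a self-avoiding plus walk, a port other than the two endpoints is flanked by the centres of
its two faces**: its predecessor and its successor on the walk are adjacent to it, hence centres of
faces having it as a side, and distinct (the walk is a path), hence the centres of BOTH faces
bordering it; so both lie on the walk. [folklore] -/
theorem faces_mem_support {u v : PVert} (p : plusLattice.Walk u v) (hp : p.IsPath) {e : MidEdge}
    (he : (Sum.inl e : PVert) ∈ p.support) (hu : (Sum.inl e : PVert) ≠ u)
    (hv : (Sum.inl e : PVert) ≠ v) :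
    (Sum.inr (e.faces.1, ()) : PVert) ∈ p.support ∧
      (Sum.inr (e.faces.2, ()) : PVert) ∈ p.support := by
  induction p with
  | nil =>
    rw [SimpleGraph.Walk.support_nil, List.mem_singleton] at he
    exact absurd he hu
  | @cons a b c h q ih =>
    rw [SimpleGraph.Walk.cons_isPath_iff] at hp
    rw [SimpleGraph.Walk.support_cons, List.mem_cons] at he
    rcases he with he | he
    · exact absurd he hu
    by_cases hb : (Sum.inl e : PVert) = b
    · subst hb
      cases q with
      | nil => exact absurd rfl hv
      | @cons _ b' _ h' q' =>
        rcases a with ea | ⟨fa, ⟨⟩⟩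
        · exact absurd h (PortGadget.lattice_adj_inl_inl _ _ _)
        rcases b' with eb | ⟨fb, ⟨⟩⟩
        · exact absurd h' (PortGadget.lattice_adj_inl_inl _ _ _)
        have hfa := (Face.exists_side_eq_iff fa e).1 ((plusLattice_adj_inr_inl e fa ()).1 h)
        have hfb := (Face.exists_side_eq_iff fb e).1 ((plusLattice_adj_inl_inr e fb ()).1 h')
        have hne : fa ≠ fb := fun hab => hp.2 (by
          rw [hab, SimpleGraph.Walk.support_cons]
          exact List.mem_cons_of_mem _ q'.start_mem_support)
        have hma : (Sum.inr (fa, ()) : PVert) ∈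
            (SimpleGraph.Walk.cons h (SimpleGraph.Walk.cons h' q')).support :=
          SimpleGraph.Walk.start_mem_support _
        have hmb : (Sum.inr (fb, ()) : PVert) ∈
            (SimpleGraph.Walk.cons h (SimpleGraph.Walk.cons h' q')).support := by
          rw [SimpleGraph.Walk.support_cons, SimpleGraph.Walk.support_cons]
          exact List.mem_cons_of_mem _ (List.mem_cons_of_mem _ q'.start_mem_support)
        rcases hfa with rfl | rfl <;> rcases hfb with rfl | rfl
        exacts [absurd rfl hne, ⟨hma, hmb⟩, ⟨hmb, hma⟩, absurd rfl hne]
    · have h2 := ih hp.1 he hb hv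
      exact ⟨List.mem_cons_of_mem _ h2.1, List.mem_cons_of_mem _ h2.2⟩

/-- **Between two centres, a self-avoiding plus path lies in the face support of `Ω` iff it lies in
the site support of the erosion `erode Ω δ`**: centres by `inr_mem_siteSupport_erode_iff`; a port
of the path is flanked by the centres of its two faces (`faces_mem_support`), which are mesh faces
of `Ω` under either hypothesis, so the port is kept by the face rule (`inl_mem_faceSupport_iff`)
and by the site rule on the erosion (`inl_mem_siteSupport_erode_of_faces_mem`). [folklore] -/
theorem forall_mem_support_faceRule_iff_siteRule_erode {Ω : Set ℂ} {δ : ℝ} {f g : Face × Unit}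
    (p : plusLattice.Walk (Sum.inr f : PVert) (Sum.inr g)) (hp : p.IsPath) :
    (∀ x ∈ p.support, x ∈ probeSupport faceRule Ω δ) ↔
      ∀ x ∈ p.support, x ∈ probeSupport siteRule (erode Ω δ) δ := by
  have key : ∀ {e : MidEdge}, (Sum.inl e : PVert) ∈ p.support →
      (Sum.inr (e.faces.1, ()) : PVert) ∈ p.support ∧
        (Sum.inr (e.faces.2, ()) : PVert) ∈ p.support :=
    fun he => faces_mem_support p hp he Sum.inl_ne_inr Sum.inl_ne_inr
  refine ⟨fun hS x hx => ?_, fun hS x hx => ?_⟩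
  · rcases x with e | ⟨f', u'⟩
    · obtain ⟨h1, h2⟩ := key hx
      exact inl_mem_siteSupport_erode_of_faces_mem (inr_mem_faceSupport_iff.1 (hS _ h1))
        (inr_mem_faceSupport_iff.1 (hS _ h2))
    · exact inr_mem_siteSupport_erode_iff.2 (hS _ hx)
  · rcases x with e | ⟨f', u'⟩
    · obtain ⟨h1, -⟩ := key hx
      exact inl_mem_faceSupport_iff.2
        (Or.inl (inr_mem_faceSupport_iff.1 (inr_mem_siteSupport_erode_iff.1 (hS _ h1))))
    · exact inr_mem_siteSupport_erode_iff.1 (hS _ hx)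

/-! ### The identity of the two centre-to-centre path laws -/

/-- **The face discretisation is the site discretisation of the one-cell erosion, on
centre-to-centre plus path laws** (exact equality of measures, every real `δ`): the critical
plus-lattice self-avoiding path law through the face support of `Ω` between two centres is the
one through the site support of `erode Ω δ` (same admissible paths, `pathLaw_congr_support`).
[folklore] -/
theorem plusPathLaw_faceRule_eq_siteRule_erode (Ω : Set ℂ) (δ : ℝ) (f g : Face × Unit) :
    plusPathLaw (probeSupport faceRule Ω δ) δ (Sum.inr f) (Sum.inr g) =
      plusPathLaw (probeSupport siteRule (erode Ω δ) δ) δ (Sum.inr f) (Sum.inr g) := by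
  unfold plusPathLaw
  exact pathLaw_congr_support fun p hp => forall_mem_support_faceRule_iff_siteRule_erode p hp

/-- The same identity spelled with site centres: the plus path law through the face support of `Ω`
from `siteCentre a` to `siteCentre b` is the one through the site support of `erode Ω δ` (the form
matching the site dictionary `stub_siteDictionary`). [folklore] -/
theorem plusPathLaw_faceRule_siteCentre_eq (Ω : Set ℂ) (δ : ℝ) (a b : Site 2) :
    plusPathLaw (probeSupport faceRule Ω δ) δ (siteCentre a) (siteCentre b) =
      plusPathLaw (probeSupport siteRule (erode Ω δ) δ) δ (siteCentre a) (siteCentre b) :=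
  plusPathLaw_faceRule_eq_siteRule_erode Ω δ _ _

/-- **The same pairs of centres are joinable** through the face support of `Ω` and through the site
support of `erode Ω δ` (same admissible self-avoiding plus paths). [folklore] -/
theorem mem_plusJoinable_faceRule_iff_siteRule_erode {Ω : Set ℂ} {δ : ℝ} {f g : Face × Unit} :
    ((Sum.inr f : PVert), (Sum.inr g : PVert)) ∈ plusJoinable (probeSupport faceRule Ω δ) ↔
      ((Sum.inr f : PVert), (Sum.inr g : PVert)) ∈
        plusJoinable (probeSupport siteRule (erode Ω δ) δ) := by
  rw [mem_plusJoinable_iff, mem_plusJoinable_iff]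
  exact exists_congr fun p => and_congr_right fun hp =>
    forall_mem_support_faceRule_iff_siteRule_erode p hp

end Summit.CriticalPhenomena.SAWScalingLimit.Theorems.SurfaceUniversality

end
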